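import Literature.MathematicalPhysics.QuantumFieldTheory.Balaban1983to89.B6MultiLevelBoxOperator
import Literature.MathematicalPhysics.QuantumFieldTheory.Balaban1983to89.B6Eq238TwoLevelBox

/-!
# `Balaban1983to89.B6Eq238MultiLevelBox` — [B6] (2.36)–(2.38) FOR THE GENUINE `k`-LEVEL OPERATOR `Δ′_a` ON A BOX:
the MULTI-SIZE cube cover `𝒟 = ⋃_{j=1}^{k} 𝒟_j` (cubes of side `2ML^jη` over `B^j(Λ_j)`, the rescaled (1.118)
profiles), the localisation [3] (2.6) — every cube operator is LITERALLY a two-level cube operator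
`B6Ineq243TwoLevelBox.twoLevelOp` at the cube's finer scale —, `G′₀ = Σ_□ h_□G′(□)h̄_□` (2.37) and
`Δ′_aG′₀ = I − Σ_□ K(h_□)G′(□)h̄_□ = I − R` (2.38) (file 2 of the multi-level parametrix; no existing module is touched;
no fact is minted)

FRAMING (verbatim cell line):
statement-level skeleton of published theorems with citation tags; proofs where landed; nothing here is a claim about the Yang–Mills mass gap

Source under audit (cell pub-balaban / lit-balaban): T. Bałaban, *Propagators and renormalization transformations for
lattice gauge theories. II*, Commun. Math. Phys. **96** (1984) 223–250 [`Balaban1984PropagatorsII`, "B6"], p. 229 [PDF 7]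
(2.36)–(2.39), p. 230 [PDF 8] (2.40)–(2.44) (renders `…/1984-cmp96-propagators-rt-II-p007-x2.png`, `-p008-x2.png` read as
images this generation); T. Bałaban, *Regularity and decay of lattice Green's functions*, Commun. Math. Phys. **89** (1983)
571–597 [`Balaban1983RegularityDecay`, "[3]"], §2 p. 575–576 ((2.2), (2.6)).  Unit `lit-balaban-p21` (Phase-2 proof seat p21
gen 10), HOME `run/shared/lean/pub/lit-balaban/`, B6 fold owner r03, referee ref-4.

## WHAT IS PRINTED (p. 229–230, verbatim up to notation)

«We cover B^j(Λ_j) by a sum of cubes □ of the size 2ML^jη, each cube being a sum of 2^d big blocks with a center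
y ∈ Λ_j (more exactly it belongs to the boundary of this set also). Taking these covers for all j from 0 to k we get a
family 𝒟 of cubes □ of different sizes and such that T_η = ⋃_{□∈𝒟} □. … We construct also the corresponding family of
functions h described in (1.118), and rescale them to proper scales. They satisfy Σ_{□∈𝒟} h_□² = 1. (2.36) … We define
G′₀ = Σ_□ h_□G′(□)h_□, (2.37) where G′(□) is an inverse of Δ′_a with some boundary conditions on the boundary of □, e.g.
with Neumann boundary conditions as in [3]. Repeating the calculations in the paper we get
Δ′_aG′₀ = I − Σ_□ K(h_□)G′(□)h_□ = I − R, (2.38)» … p. 230: «Let us assume that □ is a cube connected with a L^jη-scale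
(i.e. a cube of the size 2ML^jη) and intersecting maybe the domain B^{j+1}(Λ_{j+1}). Rescaling all the expressions in
K(h_□)G′(□)h_□λ to L^{−j}-scale, we get (2.40) … or the last term above is replaced by a term defined in the same way
but with j + 1 instead of j and with the additional factor L^{−2} if x ∈ B^{j+1}(Λ_{j+1})».  [3] (2.6): «(−Δ^{η,N}_{A,Ω})
h_jG(□_j, A_j) = (−Δ^{η,N}_{A_j,□_j})h_jG(□_j, A_j), because the function h_j can be ≠ 0 only on the part of the
boundary of □_j which is contained in the boundary of Ω.»

## WHAT THIS FILE CERTIFIES (kernel-checked; setting of `B6MultiLevelBoxOperator`)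

For a nested family `D : Domains d ℓ M_h k P R` (levels `1 … k` on the fine box `X = Π[0, L^k·L·M_h·P_μ)`), weights
`a_j` with `a_{i+1} = aNext ℓ a_i c_i`, and the `k`-level operator `E = mlOp` of file 1:
* §1 **PRESENTATIONS**: the box seen at mesh exponent `i` with cube half-width `M_h·L^{j−i}` `L`-blocks and `L^{k−j}·P_μ`
  half-widths per side (`MhP`, `Pj`, `Np_eq`) — so that the level-`j` cut cubes `□_q`, `q ∈ Π[0, L^{k−j}P_μ]`, with
  finer level `i ∈ {j − 1, j}` are EXACTLY the cut cubes of `B6Eq238TwoLevelBox` (`emb`, `cubeLo/cubeW`, `IL`, the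
  profiles `hΩ/hLoc` at half-width `M·L^j`), consumed by name;
* §2 the level-`(i+1)` part `Λ` of the presentation (`LamG`, a union of `L`-blocks: `isBlockUnion_LamG`);
* §3 **LOCALISATION = [3] (2.6) FOR THE MULTI-LEVEL OPERATOR**: if every site of the cut cube has level `i` or
  `i + 1` (the two-level window), then off the internal layer the row of `L^{2i}·E` at a cube site IS the row of the
  two-level cube operator `twoLevelOp (L^i) ℓ a_i c_i 0 (cubeM′) Λ_□` padded by zero (`mlOp_emb_emb`, `mlOp_emb_off`,
  `row_eq_pad_row`, `diagonal_mul_eq_pad`) — print's «Rescaling … to L^{−j}-scale … with j + 1 instead of j and with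
  the additional factor L^{−2}»: the multi-level operator restricted to a cube is a genuine two-level cube operator;
* §4 **ONE TERM OF (2.38)**: with `u = h_□` (the printed profile), `G = resᵀ(L^{2i}·G′(□))res` (`G′(□) = gTwoLevel`, the
  genuine cube propagator, `E_□G′(□) = 1`) and ANY right factor `v` supported in the cube,
  `E·(uGv) = uv − resᵀ(K_□(h)G′(□)v′)res` (`mlOp_mul_term`) — the `L^{2i}` cancels in the commutator term, which is the
  object bounded by (2.44) (`B6Ineq243TwoLevelBox.ineq244_twoLevel`);
* §5 **THE CUBES OF THE COVER**: a level-`j` cut cube `□_q` (`InCube`, its printed profile `uFun = h_□`, `Active` =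
  the profile meets `B^j(Λ_j)`) gets the finer level `fin = j − 1` if it meets `B^{j−1}(Λ_{j−1})` (`Down`), else `j`
  (`fin_spec`), and then EVERY site of the cube has level `fin` or `fin + 1` (`window_of_active`, from (2.2) with
  `R ≥ 2L` via `Domains.lev_window/not_both_sides`) — the two-level window §3 needs;
* §6 **(2.36)–(2.38)**: the cover `𝒟` (`cubeSet`: levels `1 ≤ j ≤ k`, active labels), left factors `u_□ = h_□` (`uX`)
  and right factors `v_□ = h_□·1_{B^j(Λ_j)}` (`vFun`, `vX`) with **`Σ_{□∈𝒟} u_□v_□ = 1`** (`sum_uv_eq_one`, (1.118) level by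
  level), the padded genuine cube propagators `G′(□)` transported to the reference presentation (`gX`, `castP`), the
  summands `h_□G′(□)v_□` (`aX`) and `K(h_□)G′(□)v_□` (`bX`, a padded LOCAL two-level commutator term), **`G′₀`**
  (`gZeroML`), **`R`** (`rML`), `Δ′_a·(h_□G′(□)v_□) = h_□v_□ − K(h_□)G′(□)v_□` per cube (`mlOp_mul_aX`) and
  **(2.38) `Δ′_a·G′₀ = 1 − R`** (`eq238_multiLevelBox`).

## HONEST SCOPE (additions to file 1's)

* The partition of unity: print's symmetric `h_□G′(□)h_□` with `Σh_□² = 1` needs a matching of the (1.118) families of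
  adjacent levels which print does not specify (cell divergence D-b06.38/42, cf. `B6CoverNested`); here the LEFT factor
  is the printed profile `h_□` rescaled to the cube's level (so `K(h_□)` is print's commutator (2.39)–(2.40)) and the
  RIGHT factor is `h_□·1_{B^j(Λ_j)}`, which makes `Σ_□ u_□v_□ = 1` exact; (2.38) and the estimates (2.44)/(2.49) are
  insensitive to the right factor beyond `|v_□| ≤ 1`.  The cover: all grid cubes of level `j` whose profile meets
  `B^j(Λ_j)` (print: «center y ∈ Λ_j (… boundary … also)»); cut cubes at `∂X` as in `B6Partition236TwoLevelBox`.
* `m² = 0`; the cube propagators are the Neumann two-level inverses of the lineage (print: «e.g. with Neumann boundary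
  conditions»); `R ≥ 2L` (print: «R is a big positive integer fixed later»); `M_h ≥ 1`, `L ≥ 2`.
* Nothing is inferred from the manuscript: every step is kernel-checked; the quoted sentences locate the statement.
-/

namespace Literature.MathematicalPhysics.QuantumFieldTheory.Balaban1983to89.B6Eq238MultiLevelBox

open Finset Matrix
open Literature.MathematicalPhysics.QuantumFieldTheory.Balaban1983to89.B4ContourShift (supNorm abs_le_supNorm
  supNorm_nonneg)
open Literature.MathematicalPhysics.QuantumFieldTheory.Balaban1983to89.B4Reflection242 (boxDom mem_boxDom nbrs mem_nbrs
  blk blk_mem_boxDom neumannLapK diagK avgK)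
open Literature.MathematicalPhysics.QuantumFieldTheory.Balaban1983to89.B4Green242Bridge (boxNbrs)
open Literature.MathematicalPhysics.QuantumFieldTheory.Balaban1983to89.B4BoxCov237 (boxOpR)
open Literature.MathematicalPhysics.QuantumFieldTheory.Balaban1983to89.B4Lemma22ReduceZero (Box)
open Literature.MathematicalPhysics.QuantumFieldTheory.Balaban1983to89.B4SubBoxCarrier
open Literature.MathematicalPhysics.QuantumFieldTheory.Balaban1983to89.B4TwoBox120 (blk_add_mul)
open Literature.MathematicalPhysics.QuantumFieldTheory.Balaban1983to89.B4Thm110ZeroBox (boxCast boxCast_apply_val boxCast_symm_apply_val blk_blk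
  mem_boxDom_of_eq)
open Literature.MathematicalPhysics.QuantumFieldTheory.Balaban1983to89.B6Ineq243TwoLevelBox
open Literature.MathematicalPhysics.QuantumFieldTheory.Balaban1983to89.B6Partition236TwoLevelBox
open Literature.MathematicalPhysics.QuantumFieldTheory.Balaban1983to89.B6Eq238TwoLevelBox
open Literature.MathematicalPhysics.QuantumFieldTheory.Balaban1983to89.B6MultiLevelBoxOperator

noncomputable section

variable {d : ℕ}

/-! ## §1 Presentations of the box at the scale of a cube -/

/-- the half-width of a level-`j` cube in `L`-blocks of level `i + 1`, divided by `L`: `M_h·L^{j−i}` (so that the cube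
half-width `L^i·L·MhP = M·L^j` fine sites, `halfWidth_eq`). [cite: Balaban1984PropagatorsII, p.229 («cubes □ of the size 2ML^jη»), dictionary] -/
def MhP (ℓ Mh j i : ℕ) : ℕ := Mh * (ℓ + 1) ^ (j - i)

/-- the number of level-`j` cube half-widths per side of the box: `L^{k−j}·P_μ`. [cite: Balaban1984PropagatorsII, p.229, dictionary] -/
def Pj (ℓ k : ℕ) (P : Fin (d + 1) → ℕ) (j : ℕ) : Fin (d + 1) → ℕ := fun μ => (ℓ + 1) ^ (k - j) * P μ

/-- `Pj ≥ 1`. [cite: Balaban1984PropagatorsII, p.229, dictionary] -/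
theorem one_le_Pj {ℓ k : ℕ} {P : Fin (d + 1) → ℕ} (hP : ∀ μ, 1 ≤ P μ) (j : ℕ) : ∀ μ, 1 ≤ Pj ℓ k P j μ :=
  fun μ => Nat.one_le_iff_ne_zero.2 (Nat.mul_ne_zero_iff.2 ⟨by positivity, by have := hP μ; omega⟩)

/-- `MhP ≥ 1`. [cite: Balaban1984PropagatorsII, p.229, dictionary] -/
theorem one_le_MhP {ℓ Mh : ℕ} (hMh : 1 ≤ Mh) (j i : ℕ) : 1 ≤ MhP ℓ Mh j i :=
  Nat.one_le_iff_ne_zero.2 (Nat.mul_ne_zero_iff.2 ⟨by omega, by positivity⟩)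

/-- **THE PRESENTATION IS THE BOX**: `L^i·(L·(MhP·Pj_μ)) = N₀_μ` for `i ≤ j ≤ k`. [cite: Balaban1984PropagatorsII, p.229–230 («Rescaling … to L^{−j}-scale»), dictionary] -/
theorem Np_eq {ℓ Mh k : ℕ} {P : Fin (d + 1) → ℕ} {j i : ℕ} (hij : i ≤ j) (hjk : j ≤ k) :
    (fun μ => (ℓ + 1) ^ i * ((ℓ + 1) * (MhP ℓ Mh j i * Pj ℓ k P j μ))) = N0 ℓ Mh k P := by
  funext μ
  obtain ⟨s, rfl⟩ := Nat.exists_eq_add_of_le hij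
  obtain ⟨t, rfl⟩ := Nat.exists_eq_add_of_le hjk
  simp only [N0, MhP, Pj, Nat.add_sub_cancel_left, show i + s + t - (i + s) = t by omega, pow_add]
  ring

/-- the cube half-width in fine sites: `L^i·(L·MhP) = M·L^j = bigSide j`. [cite: Balaban1984PropagatorsII, p.229, dictionary] -/
theorem halfWidth_eq {ℓ Mh j i : ℕ} (hij : i ≤ j) : (ℓ + 1) ^ i * ((ℓ + 1) * MhP ℓ Mh j i) = bigSide ℓ Mh j := by
  obtain ⟨s, rfl⟩ := Nat.exists_eq_add_of_le hij
  simp only [MhP, bigSide, Nat.add_sub_cancel_left, pow_add, pow_one]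
  ring

/-! ## §2 The level-`(i+1)` part of a presentation: `Λ = □^{(i)} ∩ B(Λ_{i+1})` globally -/

section Lam

variable {ℓ Mh k R : ℕ} {P : Fin (d + 1) → ℕ} (D : Domains d ℓ Mh k P R) (j i : ℕ)

/-- the base corner (a fine site) `L^i·y` of the unit block `y` of the presentation (print's blocks `B^j(y)`).
[cite: Balaban1984PropagatorsII, (2.1) p.226, dictionary] -/
def corner (i : ℕ) (y : Fin (d + 1) → ℤ) : Fin (d + 1) → ℤ := fun μ => (((ℓ + 1) ^ i : ℕ) : ℤ) * y μ

/-- **`Λ` OF (2.41) FOR THE PRESENTATION**: the unit (`i`-)blocks of the box whose sites lie in `B^{i+1}(Λ_{i+1})`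
(«Λ = □^{(j)} ∩ B(Λ_{j+1})»). [cite: Balaban1984PropagatorsII, (2.41) p.230 («where Λ = □^{(j)} ∩ B(Λ_{j+1})»)] -/
def LamG : Finset ↥(boxDom (fun μ => (ℓ + 1) * (MhP ℓ Mh j i * Pj ℓ k P j μ))) :=
  Finset.univ.filter fun y => D.lev (corner (ℓ := ℓ) i y.1) = i + 1

variable {D j i}

/-- the block index of a base corner. [folklore] -/
private theorem blk_corner {b : ℕ} (hb : 1 ≤ b) (y : Fin (d + 1) → ℤ) :
    blk b (fun μ => ((b : ℕ) : ℤ) * y μ) = y := by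
  funext μ
  have hb0 : ((b : ℕ) : ℤ) ≠ 0 := by exact_mod_cast (show b ≠ 0 by omega)
  simp only [blk]
  exact Int.mul_ediv_cancel_left _ hb0

/-- the base corner of a unit block of the presentation is a site of the box. [folklore] -/
private theorem corner_mem {M' : Fin (d + 1) → ℕ} {n : ℕ} (hn : 1 ≤ n) (y : ↥(boxDom M')) :
    (fun μ => ((n : ℕ) : ℤ) * y.1 μ) ∈ boxDom (fun μ => n * M' μ) := by
  have hy := mem_boxDom.1 y.2
  rw [mem_boxDom]
  intro μ
  obtain ⟨h1, h2⟩ := hy μ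
  have hn0 : (0 : ℤ) < n := by exact_mod_cast hn
  push_cast
  exact ⟨by positivity, by nlinarith⟩

/-- membership in `Λ`: the block's corner lies at level `i + 1`. [cite: Balaban1984PropagatorsII, (2.41) p.230] -/
theorem mem_LamG (y : ↥(boxDom (fun μ => (ℓ + 1) * (MhP ℓ Mh j i * Pj ℓ k P j μ)))) :
    y ∈ LamG D j i ↔ D.lev (corner (ℓ := ℓ) i y.1) = i + 1 := by
  simp [LamG]

/-- the level of a site `x` at level `≥ i` is the level of the corner of its `i`-block (territories are unions of
blocks, `Domains.lev_eq_of_blk_eq_of_le`). [cite: Balaban1984PropagatorsII, (2.1)+(2.3) p.224] -/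
theorem lev_corner_ublk (hij : i ≤ j) (hjk : j ≤ k)
    (x : ↥(boxDom (fun μ => (ℓ + 1) ^ i * ((ℓ + 1) * (MhP ℓ Mh j i * Pj ℓ k P j μ))))) (hi : i ≤ D.lev x.1) :
    D.lev (corner (ℓ := ℓ) i (blk ((ℓ + 1) ^ i) x.1)) = D.lev x.1 := by
  have hn : 1 ≤ (ℓ + 1) ^ i := Nat.one_le_pow _ _ (by omega)
  have hN := Np_eq (ℓ := ℓ) (Mh := Mh) (P := P) hij hjk
  have hx : x.1 ∈ boxDom (N0 ℓ Mh k P) := hN ▸ x.2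
  have hc : corner (ℓ := ℓ) i (blk ((ℓ + 1) ^ i) x.1) ∈ boxDom (N0 ℓ Mh k P) := by
    rw [← hN]
    exact corner_mem hn (ublk hn x)
  exact D.lev_eq_of_blk_eq_of_le hx hc hi (by unfold corner; rw [blk_corner hn])

/-- **`Λ` IS A UNION OF `L`-BLOCKS** (`B^{i+1}(Λ_{i+1})` is a union of `(i+1)`-blocks). [cite: Balaban1984PropagatorsII, p.230 («Λ = □^{(j)} ∩ B(Λ_{j+1})», a sum of blocks)] -/
theorem isBlockUnion_LamG (hij : i ≤ j) (hjk : j ≤ k) :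
    IsBlockUnion ℓ (fun μ => MhP ℓ Mh j i * Pj ℓ k P j μ) (LamG D j i) := by
  have hn : 1 ≤ (ℓ + 1) ^ i := Nat.one_le_pow _ _ (by omega)
  have hL : 1 ≤ ℓ + 1 := by omega
  have hN := Np_eq (ℓ := ℓ) (Mh := Mh) (P := P) hij hjk
  intro y hy y' hyy'
  rw [mem_LamG] at hy ⊢
  have hcy : corner (ℓ := ℓ) i y.1 ∈ boxDom (N0 ℓ Mh k P) := by rw [← hN]; exact corner_mem hn y
  have hcy' : corner (ℓ := ℓ) i y'.1 ∈ boxDom (N0 ℓ Mh k P) := by rw [← hN]; exact corner_mem hn y'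
  rw [← hy]
  refine D.lev_eq_of_blk_eq hcy hcy' ?_
  rw [hy, pow_succ, ← blk_blk (ℓ + 1) ((ℓ + 1) ^ i) (corner i y'.1), ← blk_blk (ℓ + 1) ((ℓ + 1) ^ i) (corner i y.1)]
  unfold corner
  rw [blk_corner hn, blk_corner hn, hyy']

end Lam

/-! ## §3 Localisation: the multi-level operator restricted to a cube is a two-level cube operator ([3] (2.6)) -/

section Localisation

variable {ℓ Mh k R : ℕ} {P : Fin (d + 1) → ℕ} (D : Domains d ℓ Mh k P R) (a c : ℕ → ℝ) (j i : ℕ)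
  (q : Fin (d + 1) → ℤ)

/-- the presentation of `Δ′_a` at mesh exponent `i` for level-`j` cubes. [cite: Balaban1984PropagatorsII, (2.13)–(2.14) p.225 with p.230 (rescaling)] -/
def Ep : Matrix ↥(Box d ℓ i (fun μ => (ℓ + 1) * (MhP ℓ Mh j i * Pj ℓ k P j μ)))
    ↥(Box d ℓ i (fun μ => (ℓ + 1) * (MhP ℓ Mh j i * Pj ℓ k P j μ))) ℝ :=
  mlOp (fun μ => (ℓ + 1) ^ i * ((ℓ + 1) * (MhP ℓ Mh j i * Pj ℓ k P j μ))) ℓ k D.lev a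

/-- **THE TWO-LEVEL CUBE OPERATOR OF THE CUT CUBE `□_q`** (levels `i`, `i + 1`; `m² = 0`):
`twoLevelOp (L^i) ℓ a_i c_i 0 (cubeM′) Λ_q` of `B6Ineq243TwoLevelBox`. [cite: Balaban1984PropagatorsII, (2.41) p.230] -/
def cOp (hP : ∀ μ, 1 ≤ P μ) (hq : q ∈ ctrs (Pj ℓ k P j)) :=
  twoLevelOp ((ℓ + 1) ^ i) ℓ (a i) (c i) 0 (cubeM' (MhP ℓ Mh j i) (Pj ℓ k P j) q)
    (lamLoc ℓ (MhP ℓ Mh j i) (Pj ℓ k P j) q (one_le_Pj hP j) hq (LamG D j i))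

/-- **THE GENUINE CUBE PROPAGATOR `G′(□_q)`** (`B6Ineq243TwoLevelBox.gTwoLevel`, the Woodbury inverse (2.42)).
[cite: Balaban1984PropagatorsII, (2.37) p.229, (2.42) p.230] -/
def cG (hP : ∀ μ, 1 ≤ P μ) (hq : q ∈ ctrs (Pj ℓ k P j)) :=
  gTwoLevel ((ℓ + 1) ^ i) ℓ (a i) (c i) 0 (cubeM' (MhP ℓ Mh j i) (Pj ℓ k P j) q)
    (lamLoc ℓ (MhP ℓ Mh j i) (Pj ℓ k P j) q (one_le_Pj hP j) hq (LamG D j i))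

variable {D a c j i q}

/-- `E_qG′(□_q) = 1` (`twoLevelOp_mul_gTwoLevel`). [cite: Balaban1984PropagatorsII, (2.41)–(2.42) p.230] -/
theorem cOp_mul_cG (hℓ : 1 ≤ ℓ) (hP : ∀ μ, 1 ≤ P μ) (hMh : 1 ≤ Mh) (hq : q ∈ ctrs (Pj ℓ k P j))
    (hij : i ≤ j) (hjk : j ≤ k) (hai : 0 < a i) (hci : 0 < c i) :
    cOp D a c j i q hP hq * cG D a c j i q hP hq = 1 := by
  have hn : 1 ≤ (ℓ + 1) ^ i := Nat.one_le_pow _ _ (by omega)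
  have hM' : ∀ μ, 1 ≤ cubeM' (MhP ℓ Mh j i) (Pj ℓ k P j) q μ := fun μ =>
    Nat.one_le_iff_ne_zero.2 (Nat.mul_ne_zero_iff.2
      ⟨by have := one_le_MhP (ℓ := ℓ) hMh j i; omega, by have := (one_le_cubeW (one_le_Pj hP j) hq μ).1; omega⟩)
  exact twoLevelOp_mul_gTwoLevel hn hℓ hai hci le_rfl hM' (isBlockUnion_lamLoc _ hq (isBlockUnion_LamG hij hjk))

/-- **THE ENTRIES OF `L^{2i}·Δ′_a` AT AN EMBEDDED PAIR ARE THE ENTRIES OF THE CUBE OPERATOR** (off the internal layer),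
when every site of the cut cube has level `i` or `i + 1`: the Laplacian part by [3] (2.6) (`degree_eq_of_not_IL`), the
level-`i` averaging term is `a_iQ_i^*Q_i` of the cube, the level-`(i+1)` term is «the additional factor L^{−2}» term
with `a_{i+1} = aNext ℓ a_i c_i`. [cite: Balaban1984PropagatorsII, (2.40)–(2.41) p.230; Balaban1983RegularityDecay, (2.6) p.576] -/
theorem mlOp_emb_emb (hℓ : 1 ≤ ℓ) (hP : ∀ μ, 1 ≤ P μ) (hq : q ∈ ctrs (Pj ℓ k P j)) (hij : i ≤ j) (hjk : j ≤ k)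
    (hac : a (i + 1) = aNext ℓ (a i) (c i))
    (hwin : ∀ b : ↥(Box d ℓ i (fun μ => (ℓ + 1) * cubeM' (MhP ℓ Mh j i) (Pj ℓ k P j) q μ)),
      D.lev (emb ℓ i (MhP ℓ Mh j i) (Pj ℓ k P j) q (one_le_Pj hP j) hq b).1 = i ∨
        D.lev (emb ℓ i (MhP ℓ Mh j i) (Pj ℓ k P j) q (one_le_Pj hP j) hq b).1 = i + 1)
    {x : ↥(Box d ℓ i (fun μ => (ℓ + 1) * cubeM' (MhP ℓ Mh j i) (Pj ℓ k P j) q μ))}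
    (hx : ¬ IL ℓ i (MhP ℓ Mh j i) (Pj ℓ k P j) q x)
    (b : ↥(Box d ℓ i (fun μ => (ℓ + 1) * cubeM' (MhP ℓ Mh j i) (Pj ℓ k P j) q μ))) :
    ((((ℓ : ℝ) + 1)) ^ i) ^ 2 * Ep D a j i (emb ℓ i (MhP ℓ Mh j i) (Pj ℓ k P j) q (one_le_Pj hP j) hq x)
        (emb ℓ i (MhP ℓ Mh j i) (Pj ℓ k P j) q (one_le_Pj hP j) hq b)
      = cOp D a c j i q hP hq x b := by
  have hn1 : 1 ≤ (ℓ + 1) ^ i := Nat.one_le_pow _ _ (by omega)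
  have hL : 1 ≤ (ℓ + 1) ^ i * (ℓ + 1) := Nat.one_le_iff_ne_zero.2 (by positivity)
  have hN := Np_eq (ℓ := ℓ) (Mh := Mh) (P := P) hij hjk
  have hinj := emb_injective (ℓ := ℓ) (k := i) (Mh := (MhP ℓ Mh j i)) (one_le_Pj hP j) hq
  unfold Ep cOp
  rw [mlOp_apply D hN, twoLevelOp_apply hn1 _ _ _ (isBlockUnion_lamLoc (one_le_Pj hP j) hq (isBlockUnion_LamG hij hjk))]
  -- (i) the Laplacian entries ([3] (2.6))
  have hval : ∀ e : ↥(Box d ℓ i (fun μ => (ℓ + 1) * cubeM' (MhP ℓ Mh j i) (Pj ℓ k P j) q μ)),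
      (emb ℓ i (MhP ℓ Mh j i) (Pj ℓ k P j) q (one_le_Pj hP j) hq e).1 = e.1 + fun μ => (((ℓ + 1) ^ i : ℕ) : ℤ) * (cubeO ℓ (MhP ℓ Mh j i) q μ : ℤ) := emb_val' (one_le_Pj hP j) hq
  have hlap : (neumannLapK (fun μ => (ℓ + 1) ^ i * ((ℓ + 1) * ((MhP ℓ Mh j i) * (Pj ℓ k P j) μ))) (emb ℓ i (MhP ℓ Mh j i) (Pj ℓ k P j) q (one_le_Pj hP j) hq x).1
        (emb ℓ i (MhP ℓ Mh j i) (Pj ℓ k P j) q (one_le_Pj hP j) hq b).1 : ℝ)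
      = neumannLapK (fun μ => (ℓ + 1) ^ i * ((ℓ + 1) * cubeM' (MhP ℓ Mh j i) (Pj ℓ k P j) q μ)) x.1 b.1 := by
    unfold neumannLapK
    have e1 : ((emb ℓ i (MhP ℓ Mh j i) (Pj ℓ k P j) q (one_le_Pj hP j) hq b).1 = (emb ℓ i (MhP ℓ Mh j i) (Pj ℓ k P j) q (one_le_Pj hP j) hq x).1) ↔ (b.1 = x.1) := by
      constructor
      · intro h; exact congrArg Subtype.val (hinj (Subtype.ext h))
      · intro h; rw [show b = x from Subtype.ext h]
    have e2 : ((emb ℓ i (MhP ℓ Mh j i) (Pj ℓ k P j) q (one_le_Pj hP j) hq b).1 ∈ nbrs (emb ℓ i (MhP ℓ Mh j i) (Pj ℓ k P j) q (one_le_Pj hP j) hq x).1) ↔ (b.1 ∈ nbrs x.1) := by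
      rw [hval, hval, mem_nbrs_add_iff]
    simp only [e1, e2, degree_eq_of_not_IL (one_le_Pj hP j) hq hx]
  -- (ii) the block conditions transported along the embedding
  have hbL : (blk ((ℓ + 1) ^ i * (ℓ + 1)) (emb ℓ i (MhP ℓ Mh j i) (Pj ℓ k P j) q (one_le_Pj hP j) hq b).1
        = blk ((ℓ + 1) ^ i * (ℓ + 1)) (emb ℓ i (MhP ℓ Mh j i) (Pj ℓ k P j) q (one_le_Pj hP j) hq x).1)
      ↔ (blk ((ℓ + 1) ^ i * (ℓ + 1)) b.1 = blk ((ℓ + 1) ^ i * (ℓ + 1)) x.1) := by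
    rw [emb_val'' (one_le_Pj hP j) hq, emb_val'' (one_le_Pj hP j) hq, blk_add_mul hL, blk_add_mul hL]
    constructor
    · intro h; exact add_right_cancel h
    · intro h; rw [h]
  have hb1 : (blk ((ℓ + 1) ^ i) (emb ℓ i (MhP ℓ Mh j i) (Pj ℓ k P j) q (one_le_Pj hP j) hq b).1 = blk ((ℓ + 1) ^ i) (emb ℓ i (MhP ℓ Mh j i) (Pj ℓ k P j) q (one_le_Pj hP j) hq x).1)
      ↔ (blk ((ℓ + 1) ^ i) b.1 = blk ((ℓ + 1) ^ i) x.1) := by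
    rw [hval, hval, blk_add_mul hn1, blk_add_mul hn1]
    constructor
    · intro h; exact add_right_cancel h
    · intro h; rw [h]
  -- (iii) membership of the unit block of `x` in `Λ_q` ↔ level `i + 1`
  have hub : (ublk hn1 (M := fun μ => (ℓ + 1) * cubeM' (MhP ℓ Mh j i) (Pj ℓ k P j) q μ) x ∈ lamLoc ℓ (MhP ℓ Mh j i) (Pj ℓ k P j) q (one_le_Pj hP j) hq (LamG D j i))
      ↔ D.lev (emb ℓ i (MhP ℓ Mh j i) (Pj ℓ k P j) q (one_le_Pj hP j) hq x).1 = i + 1 := by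
    have h1 : (ublk hn1 (M := fun μ => (ℓ + 1) * ((MhP ℓ Mh j i) * (Pj ℓ k P j) μ)) (emb ℓ i (MhP ℓ Mh j i) (Pj ℓ k P j) q (one_le_Pj hP j) hq x) ∈ LamG D j i)
        ↔ (ublk hn1 (M := fun μ => (ℓ + 1) * cubeM' (MhP ℓ Mh j i) (Pj ℓ k P j) q μ) x ∈ lamLoc ℓ (MhP ℓ Mh j i) (Pj ℓ k P j) q (one_le_Pj hP j) hq (LamG D j i)) := by
      rw [ublk_emb hn1 rfl (one_le_Pj hP j) hq x]
      simp [lamLoc]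
    rw [← h1, mem_LamG]
    have hi : i ≤ D.lev (emb ℓ i (MhP ℓ Mh j i) (Pj ℓ k P j) q (one_le_Pj hP j) hq x).1 := by rcases hwin x with h | h <;> omega
    exact Iff.of_eq (congrArg (fun t => t = i + 1) (lev_corner_ublk (D := D) hij hjk _ hi))
  rw [hlap]
  have hdiag : (diagK (0 : ℝ) x.1 b.1) = 0 := by unfold diagK; split_ifs <;> rfl
  rw [hdiag, add_zero, mul_add]
  have hn2 : ((((ℓ : ℝ) + 1)) ^ i) ^ 2 = ((((ℓ + 1) ^ i : ℕ) : ℝ)) ^ 2 := by push_cast; ring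
  rw [hn2]
  congr 1
  -- (iv) the averaging entries, by the level of `x`
  rcases hwin x with hlx | hlx
  · -- level `i`: the block of `x` is not in `Λ_q`; the term is `a_iQ_i^*Q_i`
    have hnot : ¬ (ublk hn1 (M := fun μ => (ℓ + 1) * cubeM' (MhP ℓ Mh j i) (Pj ℓ k P j) q μ) x
        ∈ lamLoc ℓ (MhP ℓ Mh j i) (Pj ℓ k P j) q (one_le_Pj hP j) hq (LamG D j i)) := by
      rw [hub]; omega
    rw [if_neg hnot, hlx]
    unfold avgK
    simp only [hb1]
    split_ifs
    · unfold levC; push_cast; field_simp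
    · rw [mul_zero]
  · -- level `i + 1`: the block of `x` is in `Λ_q`; the term is `a_{i+1}L^{−2}Q_{i+1}^*Q_{i+1}`
    have hmem : ublk hn1 (M := fun μ => (ℓ + 1) * cubeM' (MhP ℓ Mh j i) (Pj ℓ k P j) q μ) x
        ∈ lamLoc ℓ (MhP ℓ Mh j i) (Pj ℓ k P j) q (one_le_Pj hP j) hq (LamG D j i) := by
      rw [hub]; exact hlx
    rw [if_pos hmem, hlx]
    unfold avgK
    rw [pow_succ (ℓ + 1) i]
    simp only [hbL]
    split_ifs
    · unfold levC; rw [hac]; push_cast; field_simp; ring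
    · rw [mul_zero]

/-- **THE ENTRIES OF `Δ′_a` FROM AN EMBEDDED SITE TO A SITE OUTSIDE THE CUBE VANISH** (off the internal layer): not a
neighbour ([3] (2.6)) and no common block of level `i` or `i + 1`. [cite: Balaban1983RegularityDecay, (2.6) p.576] -/
theorem mlOp_emb_off (hP : ∀ μ, 1 ≤ P μ) (hq : q ∈ ctrs (Pj ℓ k P j)) (hij : i ≤ j) (hjk : j ≤ k)
    (hwin : ∀ b : ↥(Box d ℓ i (fun μ => (ℓ + 1) * cubeM' (MhP ℓ Mh j i) (Pj ℓ k P j) q μ)),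
      D.lev (emb ℓ i (MhP ℓ Mh j i) (Pj ℓ k P j) q (one_le_Pj hP j) hq b).1 = i ∨
        D.lev (emb ℓ i (MhP ℓ Mh j i) (Pj ℓ k P j) q (one_le_Pj hP j) hq b).1 = i + 1)
    {x : ↥(Box d ℓ i (fun μ => (ℓ + 1) * cubeM' (MhP ℓ Mh j i) (Pj ℓ k P j) q μ))}
    (hx : ¬ IL ℓ i (MhP ℓ Mh j i) (Pj ℓ k P j) q x)
    {z : ↥(Box d ℓ i (fun μ => (ℓ + 1) * (MhP ℓ Mh j i * Pj ℓ k P j μ)))}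
    (hz : ∀ b, emb ℓ i (MhP ℓ Mh j i) (Pj ℓ k P j) q (one_le_Pj hP j) hq b ≠ z) :
    Ep D a j i (emb ℓ i (MhP ℓ Mh j i) (Pj ℓ k P j) q (one_le_Pj hP j) hq x) z = 0 := by
  have hn1 : 1 ≤ (ℓ + 1) ^ i := Nat.one_le_pow _ _ (by omega)
  have hN := Np_eq (ℓ := ℓ) (Mh := Mh) (P := P) hij hjk
  unfold Ep
  rw [mlOp_apply D hN]
  have hne : z.1 ≠ (emb ℓ i (MhP ℓ Mh j i) (Pj ℓ k P j) q (one_le_Pj hP j) hq x).1 := fun h => hz x (Subtype.ext h.symm)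
  have hnb : z.1 ∉ nbrs (emb ℓ i (MhP ℓ Mh j i) (Pj ℓ k P j) q (one_le_Pj hP j) hq x).1 := fun h => by
    obtain ⟨b, hb⟩ := exists_emb_eq_of_nbr (one_le_Pj hP j) hq hx h
    exact hz b hb
  have hlap : (neumannLapK (fun μ => (ℓ + 1) ^ i * ((ℓ + 1) * ((MhP ℓ Mh j i) * (Pj ℓ k P j) μ))) (emb ℓ i (MhP ℓ Mh j i) (Pj ℓ k P j) q (one_le_Pj hP j) hq x).1 z.1 : ℝ)
      = 0 := by
    unfold neumannLapK; rw [if_neg hne, if_neg hnb]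
  have hbL : blk ((ℓ + 1) ^ i * (ℓ + 1)) z.1 ≠ blk ((ℓ + 1) ^ i * (ℓ + 1)) (emb ℓ i (MhP ℓ Mh j i) (Pj ℓ k P j) q (one_le_Pj hP j) hq x).1 := fun h => by
    obtain ⟨b, hb⟩ := exists_emb_eq_of_blkL (one_le_Pj hP j) hq x h
    exact hz b hb
  have hb1 : blk ((ℓ + 1) ^ i) z.1 ≠ blk ((ℓ + 1) ^ i) (emb ℓ i (MhP ℓ Mh j i) (Pj ℓ k P j) q (one_le_Pj hP j) hq x).1 := fun h => by
    obtain ⟨b, hb⟩ := exists_emb_eq_of_blk (one_le_Pj hP j) hq x h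
    exact hz b hb
  rw [hlap, zero_add]
  unfold avgK
  rcases hwin x with hlx | hlx
  · rw [hlx, if_neg hb1]
  · rw [hlx, pow_succ, if_neg hbL]

/-- **LOCALISATION, ROW FORM**: off the internal layer, the row of `L^{2i}·Δ′_a` at `emb x` is the row of the padded cube
operator `resᵀ·E_q·res`. [cite: Balaban1984PropagatorsII, (2.37)–(2.38) p.229 with [3] (2.6) p.576] -/
theorem row_eq_pad_row (hℓ : 1 ≤ ℓ) (hP : ∀ μ, 1 ≤ P μ) (hq : q ∈ ctrs (Pj ℓ k P j)) (hij : i ≤ j) (hjk : j ≤ k)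
    (hac : a (i + 1) = aNext ℓ (a i) (c i))
    (hwin : ∀ b : ↥(Box d ℓ i (fun μ => (ℓ + 1) * cubeM' (MhP ℓ Mh j i) (Pj ℓ k P j) q μ)),
      D.lev (emb ℓ i (MhP ℓ Mh j i) (Pj ℓ k P j) q (one_le_Pj hP j) hq b).1 = i ∨
        D.lev (emb ℓ i (MhP ℓ Mh j i) (Pj ℓ k P j) q (one_le_Pj hP j) hq b).1 = i + 1)
    {x : ↥(Box d ℓ i (fun μ => (ℓ + 1) * cubeM' (MhP ℓ Mh j i) (Pj ℓ k P j) q μ))}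
    (hx : ¬ IL ℓ i (MhP ℓ Mh j i) (Pj ℓ k P j) q x)
    (z : ↥(Box d ℓ i (fun μ => (ℓ + 1) * (MhP ℓ Mh j i * Pj ℓ k P j μ)))) :
    ((((ℓ : ℝ) + 1)) ^ i) ^ 2 * Ep D a j i (emb ℓ i (MhP ℓ Mh j i) (Pj ℓ k P j) q (one_le_Pj hP j) hq x) z
      = ((res (emb ℓ i (MhP ℓ Mh j i) (Pj ℓ k P j) q (one_le_Pj hP j) hq))ᵀ * cOp D a c j i q hP hq
          * res (emb ℓ i (MhP ℓ Mh j i) (Pj ℓ k P j) q (one_le_Pj hP j) hq))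
          (emb ℓ i (MhP ℓ Mh j i) (Pj ℓ k P j) q (one_le_Pj hP j) hq x) z := by
  have hinj := emb_injective (ℓ := ℓ) (k := i) (Mh := MhP ℓ Mh j i) (one_le_Pj hP j) hq
  rw [Matrix.mul_assoc, transpose_res_mul_apply_img hinj]
  by_cases hz : ∃ b, emb ℓ i (MhP ℓ Mh j i) (Pj ℓ k P j) q (one_le_Pj hP j) hq b = z
  · obtain ⟨b, rfl⟩ := hz
    rw [mul_res_apply_img hinj, mlOp_emb_emb hℓ hP hq hij hjk hac hwin hx b]
  · push Not at hz
    rw [mul_res_apply_off _ _ _ hz, mlOp_emb_off hP hq hij hjk hwin hx hz, mul_zero]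

/-- **LOCALISATION, OPERATOR FORM ([3] (2.6) for the multi-level operator)**: for every multiplication operator `h` on
the box supported in `□_q` off its internal layer, `h·(L^{2i}Δ′_a) = h·(resᵀE_q res)`. [cite: Balaban1984PropagatorsII, (2.38) p.229; Balaban1983RegularityDecay, (2.6) p.576] -/
theorem diagonal_mul_eq_pad (hℓ : 1 ≤ ℓ) (hP : ∀ μ, 1 ≤ P μ) (hq : q ∈ ctrs (Pj ℓ k P j)) (hij : i ≤ j) (hjk : j ≤ k)
    (hac : a (i + 1) = aNext ℓ (a i) (c i))
    (hwin : ∀ b : ↥(Box d ℓ i (fun μ => (ℓ + 1) * cubeM' (MhP ℓ Mh j i) (Pj ℓ k P j) q μ)),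
      D.lev (emb ℓ i (MhP ℓ Mh j i) (Pj ℓ k P j) q (one_le_Pj hP j) hq b).1 = i ∨
        D.lev (emb ℓ i (MhP ℓ Mh j i) (Pj ℓ k P j) q (one_le_Pj hP j) hq b).1 = i + 1)
    (h : ↥(Box d ℓ i (fun μ => (ℓ + 1) * (MhP ℓ Mh j i * Pj ℓ k P j μ))) → ℝ)
    (hh : ∀ z, h z ≠ 0 → ∃ x, emb ℓ i (MhP ℓ Mh j i) (Pj ℓ k P j) q (one_le_Pj hP j) hq x = z ∧
      ¬ IL ℓ i (MhP ℓ Mh j i) (Pj ℓ k P j) q x) :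
    Matrix.diagonal h * (((((ℓ : ℝ) + 1)) ^ i) ^ 2 • Ep D a j i)
      = Matrix.diagonal h * ((res (emb ℓ i (MhP ℓ Mh j i) (Pj ℓ k P j) q (one_le_Pj hP j) hq))ᵀ
          * cOp D a c j i q hP hq * res (emb ℓ i (MhP ℓ Mh j i) (Pj ℓ k P j) q (one_le_Pj hP j) hq)) := by
  ext z z'
  rw [Matrix.diagonal_mul, Matrix.diagonal_mul]
  by_cases hz : h z = 0
  · rw [hz, zero_mul, zero_mul]
  · obtain ⟨x, rfl, hx⟩ := hh z hz
    rw [Matrix.smul_apply, smul_eq_mul, row_eq_pad_row hℓ hP hq hij hjk hac hwin hx]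

end Localisation

/-! ## §4 One term of (2.38): `Δ′_a·(h_□G′(□)v) = h_□v − resᵀ(K_□(h_□)G′(□)v)res` -/

section OneTerm

variable {ℓ Mh k R : ℕ} {P : Fin (d + 1) → ℕ} {D : Domains d ℓ Mh k P R} {a c : ℕ → ℝ} {j i : ℕ}
  {q : Fin (d + 1) → ℤ}

/-- `D·diag g = diag g·D − K(g)` (the definition of the commutator `K`, `B6Ineq243TwoLevelBox.kComm`).
[cite: Balaban1984PropagatorsII, (2.38)–(2.39) p.229] -/
theorem mul_diagonal_eq_sub_kComm {N : Fin (d + 1) → ℕ} (T : Matrix ↥(boxDom N) ↥(boxDom N) ℝ)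
    (g : ↥(boxDom N) → ℝ) : T * Matrix.diagonal g = Matrix.diagonal g * T - kComm T g := by
  unfold kComm; abel

/-- **THE ALGEBRA OF ONE TERM OF (2.38)** over abstract carriers: if `h·(sE) = h·(resᵀ C res)` (localisation) for
symmetric `E`, `C`, `CG = 1` and `h` supported in the image of the injective `e`, then for every right factor `v`
`E·(h·resᵀ(sG)res·v) = h v − resᵀ((h′C − Ch′)·G·v′)res`, `h′ = h ∘ e`, `v′ = v ∘ e`.
[cite: Balaban1984PropagatorsII, (2.37)–(2.38) p.229; Balaban1983RegularityDecay, (2.6) p.576] -/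
theorem term_algebra {X X' : Type*} [Fintype X] [Fintype X'] [DecidableEq X] [DecidableEq X'] {e : X' → X}
    (he : Function.Injective e) (E : Matrix X X ℝ) (C G : Matrix X' X' ℝ) (h v : X → ℝ) (s : ℝ)
    (hloc : Matrix.diagonal h * (s • E) = Matrix.diagonal h * ((res e)ᵀ * C * res e)) (hE : Eᵀ = E)
    (hC : Cᵀ = C) (hCG : C * G = 1) (hsupp : ∀ x, h x ≠ 0 → ∃ a', e a' = x) :
    E * (Matrix.diagonal h * ((res e)ᵀ * (s • G) * res e) * Matrix.diagonal v)
      = Matrix.diagonal (fun x => h x * v x)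
        - (res e)ᵀ * ((Matrix.diagonal (h ∘ e) * C - C * Matrix.diagonal (h ∘ e)) * G * Matrix.diagonal (v ∘ e))
          * res e := by
  have hEs : (s • E)ᵀ = s • E := by rw [Matrix.transpose_smul, hE]
  have hEU : (s • E) * Matrix.diagonal h = (res e)ᵀ * C * res e * Matrix.diagonal h := by
    have := congrArg Matrix.transpose hloc
    rw [Matrix.transpose_mul, Matrix.transpose_mul, Matrix.diagonal_transpose, hEs, Matrix.transpose_mul,
      Matrix.transpose_mul, Matrix.transpose_transpose, hC, ← Matrix.mul_assoc] at this
    exact this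
  have hrU := res_mul_diagonal e h
  have hrV := res_mul_diagonal e v
  have hrr := res_mul_transpose_res he
  have step1 : E * (Matrix.diagonal h * ((res e)ᵀ * (s • G) * res e) * Matrix.diagonal v)
      = ((s • E) * Matrix.diagonal h) * ((res e)ᵀ * G * res e) * Matrix.diagonal v := by
    simp only [Matrix.mul_smul, Matrix.smul_mul, Matrix.mul_assoc]
  rw [step1, hEU]
  have hsupp' : ∀ x, h x * v x ≠ 0 → ∃ a', e a' = x := fun x hx => hsupp x (left_ne_zero_of_mul hx)
  have hdiag : (res e)ᵀ * (Matrix.diagonal (h ∘ e) * Matrix.diagonal (v ∘ e)) * res e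
      = Matrix.diagonal (fun x => h x * v x) := by
    rw [Matrix.diagonal_mul_diagonal]
    have e1 : (fun t => (h ∘ e) t * (v ∘ e) t) = (fun x => h x * v x) ∘ e := rfl
    rw [e1, ← diagonal_mul_transpose_res, Matrix.mul_assoc, diagonal_mul_transpose_res_mul_res he _ hsupp']
  have hK : C * Matrix.diagonal (h ∘ e)
      = Matrix.diagonal (h ∘ e) * C - (Matrix.diagonal (h ∘ e) * C - C * Matrix.diagonal (h ∘ e)) := by
    rw [sub_sub_cancel]
  calc (res e)ᵀ * C * res e * Matrix.diagonal h * ((res e)ᵀ * G * res e) * Matrix.diagonal v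
      = (res e)ᵀ * C * (res e * Matrix.diagonal h) * (res e)ᵀ * G * (res e * Matrix.diagonal v) := by
        simp only [Matrix.mul_assoc]
    _ = (res e)ᵀ * (C * Matrix.diagonal (h ∘ e) * ((res e * (res e)ᵀ) * G) * Matrix.diagonal (v ∘ e))
          * res e := by
        rw [hrU, hrV]; simp only [Matrix.mul_assoc]
    _ = (res e)ᵀ * ((Matrix.diagonal (h ∘ e) * C - (Matrix.diagonal (h ∘ e) * C - C * Matrix.diagonal (h ∘ e)))
          * G * Matrix.diagonal (v ∘ e)) * res e := by
        rw [hrr, Matrix.one_mul, ← hK]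
    _ = (res e)ᵀ * (Matrix.diagonal (h ∘ e) * (C * G) * Matrix.diagonal (v ∘ e)) * res e
        - (res e)ᵀ * ((Matrix.diagonal (h ∘ e) * C - C * Matrix.diagonal (h ∘ e)) * G * Matrix.diagonal (v ∘ e))
          * res e := by
        simp only [Matrix.sub_mul, Matrix.mul_sub, Matrix.mul_assoc]
    _ = _ := by
        rw [hCG, Matrix.mul_one, hdiag]

/-- **ONE TERM OF (2.38) FOR THE MULTI-LEVEL OPERATOR**: for the cut cube `□_q` of level `j` (finer level `i`, two-level
window), the printed left cut-off `h_□ = hΩ`, the genuine cube propagator `G′(□) = L^{2i}·gTwoLevel` padded by zero and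
ANY right factor `v`:  `Δ′_a·(h_□ G′(□) v) = h_□v − resᵀ·(K_□(h_□)·gTwoLevel·(v∘emb))·res` — localisation [3] (2.6),
`E_□G′(□) = 1` and `res·resᵀ = 1`; the scale factor `L^{2i}` cancels in the commutator term.
[cite: Balaban1984PropagatorsII, (2.37)–(2.38) p.229, (2.40) p.230] -/
theorem mlOp_mul_term (hℓ : 1 ≤ ℓ) (hP : ∀ μ, 1 ≤ P μ) (hMh : 1 ≤ Mh) (hq : q ∈ ctrs (Pj ℓ k P j))
    (hi : 1 ≤ i) (hij : i ≤ j) (hjk : j ≤ k) (hai : 0 < a i) (hci : 0 < c i)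
    (hac : a (i + 1) = aNext ℓ (a i) (c i))
    (hwin : ∀ b : ↥(Box d ℓ i (fun μ => (ℓ + 1) * cubeM' (MhP ℓ Mh j i) (Pj ℓ k P j) q μ)),
      D.lev (emb ℓ i (MhP ℓ Mh j i) (Pj ℓ k P j) q (one_le_Pj hP j) hq b).1 = i ∨
        D.lev (emb ℓ i (MhP ℓ Mh j i) (Pj ℓ k P j) q (one_le_Pj hP j) hq b).1 = i + 1)
    (v : ↥(Box d ℓ i (fun μ => (ℓ + 1) * (MhP ℓ Mh j i * Pj ℓ k P j μ))) → ℝ) :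
    Ep D a j i * (Matrix.diagonal (hΩ ℓ i (MhP ℓ Mh j i) (Pj ℓ k P j) q)
        * ((res (emb ℓ i (MhP ℓ Mh j i) (Pj ℓ k P j) q (one_le_Pj hP j) hq))ᵀ
            * (((((ℓ : ℝ) + 1)) ^ i) ^ 2 • cG D a c j i q hP hq)
            * res (emb ℓ i (MhP ℓ Mh j i) (Pj ℓ k P j) q (one_le_Pj hP j) hq))
        * Matrix.diagonal v)
      = Matrix.diagonal (fun z => hΩ ℓ i (MhP ℓ Mh j i) (Pj ℓ k P j) q z * v z)
        - (res (emb ℓ i (MhP ℓ Mh j i) (Pj ℓ k P j) q (one_le_Pj hP j) hq))ᵀ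
          * (kComm (cOp D a c j i q hP hq) (hLoc ℓ i (MhP ℓ Mh j i) (Pj ℓ k P j) q) * cG D a c j i q hP hq
              * Matrix.diagonal (v ∘ emb ℓ i (MhP ℓ Mh j i) (Pj ℓ k P j) q (one_le_Pj hP j) hq))
          * res (emb ℓ i (MhP ℓ Mh j i) (Pj ℓ k P j) q (one_le_Pj hP j) hq) := by
  have hMh' : 1 ≤ MhP ℓ Mh j i := one_le_MhP hMh j i
  have hinj := emb_injective (ℓ := ℓ) (k := i) (Mh := MhP ℓ Mh j i) (one_le_Pj hP j) hq
  have hloc := diagonal_mul_eq_pad (D := D) (a := a) (c := c) hℓ hP hq hij hjk hac hwin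
    (hΩ ℓ i (MhP ℓ Mh j i) (Pj ℓ k P j) q) (hΩ_support hℓ hi hMh' (one_le_Pj hP j) hq)
  have hE : (Ep D a j i)ᵀ = Ep D a j i := (mlOp_isSymm _ _ _ _).eq
  have hC : (cOp D a c j i q hP hq)ᵀ = cOp D a c j i q hP hq := (twoLevelOp_isSymm _ _ _ _ _ _ _).eq
  have hEG := cOp_mul_cG (D := D) (a := a) (c := c) hℓ hP hMh hq hij hjk hai hci
  rw [term_algebra hinj _ _ _ _ v _ hloc hE hC hEG
    (fun z hz => exists_emb_eq_of_hΩ_ne_zero hℓ hi hMh' (one_le_Pj hP j) hq hz), kComm,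
    hΩ_comp_emb (ℓ := ℓ) (k := i) hMh' (one_le_Pj hP j) hq]

end OneTerm

/-! ## §5 The cover 𝒟 of p. 229 on the box, the window of an active cube, and (2.36)–(2.38) -/

section Cover

variable {ℓ Mh k R : ℕ} {P : Fin (d + 1) → ℕ} (D : Domains d ℓ Mh k P R)

/-- the sites of the cut cube `□_q` of level `j` (fine coordinates: `[N_j(q − 1), N_j(q + 1)) ∩ [0, N_jP_j)` per axis,
`N_j = M·L^j`). [cite: Balaban1984PropagatorsII, p.229 («cubes □ of the size 2ML^jη … with a center y»); Balaban1983RegularityDecay, §2 p.575] -/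
def InCube (ℓ Mh k : ℕ) (P : Fin (d + 1) → ℕ) (j : ℕ) (q z : Fin (d + 1) → ℤ) : Prop :=
  ∀ μ, ((bigSide ℓ Mh j * cubeLo q μ : ℕ) : ℤ) ≤ z μ ∧
    z μ < ((bigSide ℓ Mh j * (cubeLo q μ + cubeW (Pj ℓ k P j) q μ) : ℕ) : ℤ)

/-- the level-`j` profile `h_□` of the cube `(j, q)` on the fine lattice (half-width `M·L^j`), the LEFT cut-off.
[cite: Balaban1984PropagatorsII, (2.36) p.229; Balaban1984PropagatorsI, (1.118) p.36] -/
def uFun (ℓ Mh : ℕ) (j : ℕ) (q z : Fin (d + 1) → ℤ) : ℝ := hq ((ℓ + 1) ^ j) ((ℓ + 1) * Mh) q z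

/-- **ACTIVE CUBES**: the level-`j` cube `(j, q)` enters the cover iff its profile meets `B^j(Λ_j)` («center y ∈ Λ_j
(more exactly it belongs to the boundary of this set also)»). [cite: Balaban1984PropagatorsII, p.229] -/
def Active (j : ℕ) (q : Fin (d + 1) → ℤ) : Prop :=
  ∃ z ∈ boxDom (N0 ℓ Mh k P), D.lev z = j ∧ uFun ℓ Mh j q z ≠ 0

/-- the cube meets the territory of the level below («□ ⊂ B^j(Λ_j)» fails downwards). [cite: Balaban1984PropagatorsII, p.230] -/
def Down (j : ℕ) (q : Fin (d + 1) → ℤ) : Prop :=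
  ∃ z ∈ boxDom (N0 ℓ Mh k P), InCube ℓ Mh k P j q z ∧ D.lev z + 1 = j

open Classical in
/-- **THE FINER LEVEL OF THE CUBE**: `j − 1` if it meets `B^{j−1}(Λ_{j−1})`, else `j` («□ … intersecting maybe the domain
B^{j+1}(Λ_{j+1})»). [cite: Balaban1984PropagatorsII, p.230] -/
def fin (j : ℕ) (q : Fin (d + 1) → ℤ) : ℕ := if Down D j q then j - 1 else j

variable {D}

/-- the half-width arithmetic of the presentation: `L^i·(L·(MhP·t)) = bigSide j·t`. [cite: Balaban1984PropagatorsII, p.229, dictionary] -/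
private theorem scale_mul {j i : ℕ} (hij : i ≤ j) (t : ℕ) :
    (ℓ + 1) ^ i * ((ℓ + 1) * (MhP ℓ Mh j i * t)) = bigSide ℓ Mh j * t := by
  rw [← halfWidth_eq hij]; ring

/-- **THE CUT CUBE IS THE IMAGE OF `emb`** (in any presentation `i ≤ j`). [cite: Balaban1983RegularityDecay, §2 p.575, dictionary] -/
theorem inCube_iff_exists_emb (hP : ∀ μ, 1 ≤ P μ) {j i : ℕ} (hij : i ≤ j) {q : Fin (d + 1) → ℤ}
    (hq : q ∈ ctrs (Pj ℓ k P j)) (z : ↥(Box d ℓ i (fun μ => (ℓ + 1) * (MhP ℓ Mh j i * Pj ℓ k P j μ)))) :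
    InCube ℓ Mh k P j q z.1 ↔ ∃ b, emb ℓ i (MhP ℓ Mh j i) (Pj ℓ k P j) q (one_le_Pj hP j) hq b = z := by
  rw [emb, ← inSub_iff]
  unfold inSub InCube cubeO cubeM'
  refine forall_congr' fun μ => ?_
  have e1 : ((bigSide ℓ Mh j * cubeLo q μ : ℕ) : ℤ) = (((ℓ + 1) ^ i : ℕ) : ℤ) * (((ℓ + 1) * (MhP ℓ Mh j i * cubeLo q μ) : ℕ) : ℤ) := by
    rw [← Nat.cast_mul, scale_mul hij]
  have e2 : ((bigSide ℓ Mh j * (cubeLo q μ + cubeW (Pj ℓ k P j) q μ) : ℕ) : ℤ)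
      = (((ℓ + 1) ^ i : ℕ) : ℤ) * ((((ℓ + 1) * (MhP ℓ Mh j i * cubeLo q μ) : ℕ) : ℤ)
          + (((ℓ + 1) * (MhP ℓ Mh j i * cubeW (Pj ℓ k P j) q μ) : ℕ) : ℤ)) := by
    rw [← Nat.cast_add, ← Nat.cast_mul, ← scale_mul hij]; push_cast; ring
  rw [e1, e2]

/-- two sites of a cut cube of level `j` are less than `2ML^j` apart. [cite: Balaban1984PropagatorsII, p.229 («cubes □ of the size 2ML^jη»)] -/
theorem supNorm_lt_of_inCube (hP : ∀ μ, 1 ≤ P μ) {j : ℕ} {q : Fin (d + 1) → ℤ} (hq : q ∈ ctrs (Pj ℓ k P j))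
    {z z' : Fin (d + 1) → ℤ} (hz : InCube ℓ Mh k P j q z) (hz' : InCube ℓ Mh k P j q z') :
    supNorm (z - z') < 2 * (bigSide ℓ Mh j : ℝ) := by
  obtain ⟨μ, hμ⟩ := B4ContourShift.exists_supNorm_eq (z - z')
  rw [hμ]
  obtain ⟨h1, h2⟩ := hz μ
  obtain ⟨h1', h2'⟩ := hz' μ
  have hw := (one_le_cubeW (one_le_Pj hP j) hq μ).2
  have hb : (0 : ℤ) ≤ bigSide ℓ Mh j := by positivity
  have hlt : |(z - z') μ| < 2 * (bigSide ℓ Mh j : ℤ) := by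
    rw [Pi.sub_apply, abs_lt]
    push_cast at h1 h2 h1' h2'
    have : (bigSide ℓ Mh j : ℤ) * (cubeW (Pj ℓ k P j) q μ : ℤ) ≤ (bigSide ℓ Mh j : ℤ) * 2 :=
      mul_le_mul_of_nonneg_left (by exact_mod_cast hw) hb
    constructor <;> nlinarith
  exact_mod_cast hlt

/-- the profile of an embedded site is the local profile; in particular an active witness lies in the cube.
[cite: Balaban1984PropagatorsII, (2.36) p.229] -/
theorem uFun_eq_hΩ {j i : ℕ} (hij : i ≤ j) (q : Fin (d + 1) → ℤ)
    (z : ↥(Box d ℓ i (fun μ => (ℓ + 1) * (MhP ℓ Mh j i * Pj ℓ k P j μ)))) :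
    uFun ℓ Mh j q z.1 = hΩ ℓ i (MhP ℓ Mh j i) (Pj ℓ k P j) q z := by
  unfold uFun hΩ hq
  have : (ℓ + 1) ^ j * ((ℓ + 1) * Mh) = (ℓ + 1) ^ i * ((ℓ + 1) * MhP ℓ Mh j i) := by
    rw [halfWidth_eq hij]; unfold bigSide; ring
  rw [this]

/-- **THE TWO-LEVEL WINDOW OF AN ACTIVE CUBE** (from (2.2) via `Domains.lev_window/not_both_sides`, `R ≥ 2L`): if
the finer level `i` is `j − 1` when the cube meets `B^{j−1}(Λ_{j−1})` and `j` otherwise, every site of the cut cube has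
level `i` or `i + 1`. [cite: Balaban1984PropagatorsII, (2.2) p.224 with p.230 («intersecting maybe the domain B^{j+1}(Λ_{j+1})»)] -/
theorem window_of_active (hℓ : 1 ≤ ℓ) (hR : 2 * (ℓ + 1) ≤ R) (hP : ∀ μ, 1 ≤ P μ) (hMh : 1 ≤ Mh) {j i : ℕ}
    (hi : 1 ≤ i) (hij : i ≤ j) (hjk : j ≤ k) {q : Fin (d + 1) → ℤ} (hq : q ∈ ctrs (Pj ℓ k P j))
    (hact : Active D j q) (hdown : Down D j q → i + 1 = j) (hup : ¬ Down D j q → i = j)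
    (b : ↥(Box d ℓ i (fun μ => (ℓ + 1) * cubeM' (MhP ℓ Mh j i) (Pj ℓ k P j) q μ))) :
    D.lev (emb ℓ i (MhP ℓ Mh j i) (Pj ℓ k P j) q (one_le_Pj hP j) hq b).1 = i ∨
      D.lev (emb ℓ i (MhP ℓ Mh j i) (Pj ℓ k P j) q (one_le_Pj hP j) hq b).1 = i + 1 := by
  have hN := Np_eq (ℓ := ℓ) (Mh := Mh) (P := P) hij hjk
  have hMh' : 1 ≤ MhP ℓ Mh j i := one_le_MhP hMh j i
  obtain ⟨t, ht, htj, htu⟩ := hact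
  -- the witness `t` lies in the cube
  have htmem : t ∈ Box d ℓ i (fun μ => (ℓ + 1) * (MhP ℓ Mh j i * Pj ℓ k P j μ)) := mem_boxDom_of_eq hN.symm ht
  have htΩ : hΩ ℓ i (MhP ℓ Mh j i) (Pj ℓ k P j) q ⟨t, htmem⟩ ≠ 0 := by
    rw [← uFun_eq_hΩ hij q ⟨t, htmem⟩]; exact htu
  obtain ⟨x₀, hx₀⟩ := exists_emb_eq_of_hΩ_ne_zero hℓ hi hMh' (one_le_Pj hP j) hq htΩ
  have htcube : InCube ℓ Mh k P j q t :=
    (inCube_iff_exists_emb (Mh := Mh) hP hij hq ⟨t, htmem⟩).2 ⟨x₀, hx₀⟩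
  have hbcube : InCube ℓ Mh k P j q (emb ℓ i (MhP ℓ Mh j i) (Pj ℓ k P j) q (one_le_Pj hP j) hq b).1 :=
    (inCube_iff_exists_emb (Mh := Mh) hP hij hq _).2 ⟨b, rfl⟩
  have hbmem : (emb ℓ i (MhP ℓ Mh j i) (Pj ℓ k P j) q (one_le_Pj hP j) hq b).1 ∈ boxDom (N0 ℓ Mh k P) :=
    mem_boxDom_of_eq hN (emb ℓ i (MhP ℓ Mh j i) (Pj ℓ k P j) q (one_le_Pj hP j) hq b).2
  have hwin := D.lev_window hR ht hbmem htj (supNorm_lt_of_inCube hP hq hbcube htcube)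
  by_cases hd : Down D j q
  · have hi1 := hdown hd
    obtain ⟨z₁, hz₁, hz₁c, hz₁l⟩ := hd
    rcases Nat.lt_or_ge (D.lev (emb ℓ i (MhP ℓ Mh j i) (Pj ℓ k P j) q (one_le_Pj hP j) hq b).1) (j + 1) with hlt | hge
    · omega
    · exfalso
      exact D.not_both_sides hℓ hR hz₁ hbmem (supNorm_lt_of_inCube hP hq hz₁c htcube)
        (supNorm_lt_of_inCube hP hq hbcube htcube) hz₁l (by omega)
  · have hi1 := hup hd
    have hne : D.lev (emb ℓ i (MhP ℓ Mh j i) (Pj ℓ k P j) q (one_le_Pj hP j) hq b).1 + 1 ≠ j := fun h =>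
      hd ⟨_, hbmem, hbcube, h⟩
    omega

/-- the finer level is `j − 1` or `j`, and at least `1`. [cite: Balaban1984PropagatorsII, p.230] -/
theorem fin_spec {j : ℕ} {q : Fin (d + 1) → ℤ} (hj : 1 ≤ j) (hlev : ∀ z ∈ boxDom (N0 ℓ Mh k P), InCube ℓ Mh k P j q z → 1 ≤ D.lev z) :
    1 ≤ fin D j q ∧ fin D j q ≤ j ∧ j ≤ fin D j q + 1 ∧ (Down D j q → fin D j q + 1 = j) ∧
      (¬ Down D j q → fin D j q = j) := by
  unfold fin
  by_cases hd : Down D j q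
  · obtain ⟨z, hz, hzc, hzl⟩ := hd
    have h1 := hlev z hz hzc
    rw [if_pos (show Down D j q from ⟨z, hz, hzc, hzl⟩)]
    exact ⟨by omega, by omega, by omega, fun _ => by omega, fun h => absurd ⟨z, hz, hzc, hzl⟩ h⟩
  · rw [if_neg hd]
    exact ⟨hj, le_rfl, by omega, fun h => absurd h hd, fun _ => rfl⟩

end Cover

/-! ## §6 `G′₀`, `R` and (2.38) on the reference presentation of the box -/

section Assembly

variable {ℓ Mh k R : ℕ} {P : Fin (d + 1) → ℕ} (D : Domains d ℓ Mh k P R) (a c : ℕ → ℝ)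

open Classical in
/-- **THE COVER 𝒟** as a finite index set: pairs `(j, q)` of a level `1 ≤ j ≤ k` and an active cut cube of that level.
[cite: Balaban1984PropagatorsII, p.229 («a family 𝒟 of cubes □ of different sizes»)] -/
def cubeSet : Finset (ℕ × (Fin (d + 1) → ℤ)) :=
  ((Finset.Icc 1 k) ×ˢ ctrs (Pj ℓ k P 1)).filter fun cq => cq.2 ∈ ctrs (Pj ℓ k P cq.1) ∧ Active D cq.1 cq.2

variable {D}

/-- the label sets shrink with the level: `ctrs (Pj j) ⊆ ctrs (Pj 1)` for `j ≥ 1`. [cite: Balaban1984PropagatorsII, p.229, dictionary] -/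
theorem ctrs_Pj_subset {j : ℕ} (hj : 1 ≤ j) : ctrs (Pj ℓ k P j) ⊆ ctrs (Pj ℓ k P 1) := by
  intro q hq
  rw [mem_ctrs] at hq ⊢
  intro μ
  obtain ⟨h0, h1⟩ := hq μ
  refine ⟨h0, h1.trans ?_⟩
  unfold Pj
  exact_mod_cast Nat.mul_le_mul_right _ (Nat.pow_le_pow_right (by omega) (by omega))

/-- membership in the cover. [cite: Balaban1984PropagatorsII, p.229] -/
theorem mem_cubeSet {cq : ℕ × (Fin (d + 1) → ℤ)} :
    cq ∈ cubeSet D ↔ (1 ≤ cq.1 ∧ cq.1 ≤ k) ∧ cq.2 ∈ ctrs (Pj ℓ k P cq.1) ∧ Active D cq.1 cq.2 := by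
  classical
  unfold cubeSet
  rw [Finset.mem_filter, Finset.mem_product, Finset.mem_Icc]
  constructor
  · rintro ⟨⟨hj, -⟩, hq, ha⟩
    exact ⟨hj, hq, ha⟩
  · rintro ⟨hj, hq, ha⟩
    exact ⟨⟨hj, ctrs_Pj_subset hj.1 hq⟩, hq, ha⟩

variable (D)

/-- data of an active cube: level in `[1, k]`, label, activity. [cite: Balaban1984PropagatorsII, p.229–230] -/
structure CubeData (cq : ℕ × (Fin (d + 1) → ℤ)) : Prop where
  hj : 1 ≤ cq.1 ∧ cq.1 ≤ k
  hq : cq.2 ∈ ctrs (Pj ℓ k P cq.1)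
  hact : Active D cq.1 cq.2

variable {D} in
/-- members of the cover carry `CubeData`. [cite: Balaban1984PropagatorsII, p.229] -/
theorem cubeData_of_mem {cq : ℕ × (Fin (d + 1) → ℤ)} (h : cq ∈ cubeSet D) : CubeData D cq :=
  let ⟨hj, hq, hact⟩ := mem_cubeSet.1 h
  ⟨hj, hq, hact⟩

variable {D} in
/-- the finer level of an active cube: `1 ≤ i ≤ j ≤ i + 1` and the framing conditions. [cite: Balaban1984PropagatorsII, p.230] -/
theorem fin_data {cq : ℕ × (Fin (d + 1) → ℤ)} (hc : CubeData D cq) :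
    1 ≤ fin D cq.1 cq.2 ∧ fin D cq.1 cq.2 ≤ cq.1 ∧ cq.1 ≤ fin D cq.1 cq.2 + 1 ∧
      (Down D cq.1 cq.2 → fin D cq.1 cq.2 + 1 = cq.1) ∧ (¬ Down D cq.1 cq.2 → fin D cq.1 cq.2 = cq.1) :=
  fin_spec hc.hj.1 fun z _ _ => D.one_le_lev z

/-- the cast from the presentation `(j, i)` to the reference presentation of the box. [cite: Balaban1984PropagatorsII, p.229–230 (rescaling), dictionary] -/
def castP {j i : ℕ} (hij : i ≤ j) (hjk : j ≤ k) :
    ↥(Box d ℓ i (fun μ => (ℓ + 1) * (MhP ℓ Mh j i * Pj ℓ k P j μ))) ≃ ↥(boxDom (N0 ℓ Mh k P)) :=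
  boxCast (Np_eq hij hjk)

/-- the RIGHT cut-off of the cube `(j, q)`: `v_□ = h_□·1_{B^j(Λ_j)}`. [cite: Balaban1984PropagatorsII, (2.36)–(2.37) p.229] -/
def vFun (j : ℕ) (q z : Fin (d + 1) → ℤ) : ℝ := uFun ℓ Mh j q z * (if D.lev z = j then 1 else 0)

/-- the LEFT cut-off `u_□ = h_□` of a member of the cover, on the reference presentation. [cite: Balaban1984PropagatorsII, (2.36)–(2.37) p.229] -/
def uX (cq : ℕ × (Fin (d + 1) → ℤ)) (z : ↥(boxDom (N0 ℓ Mh k P))) : ℝ := uFun ℓ Mh cq.1 cq.2 z.1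

/-- the RIGHT cut-off `v_□` of a member of the cover, on the reference presentation. [cite: Balaban1984PropagatorsII, (2.36)–(2.37) p.229] -/
def vX (cq : ℕ × (Fin (d + 1) → ℤ)) (z : ↥(boxDom (N0 ℓ Mh k P))) : ℝ := vFun D cq.1 cq.2 z.1

/-- **THE PADDED CUBE PROPAGATOR `G′(□)`** of a member of the cover on the reference presentation:
`resᵀ·(L^{2i}·gTwoLevel)·res` transported by the cast. [cite: Balaban1984PropagatorsII, (2.37) p.229] -/
def gX (hP : ∀ μ, 1 ≤ P μ) (cq : ℕ × (Fin (d + 1) → ℤ)) (hc : CubeData D cq) :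
    Matrix ↥(boxDom (N0 ℓ Mh k P)) ↥(boxDom (N0 ℓ Mh k P)) ℝ :=
  Matrix.reindex (castP (fin_data hc).2.1 hc.hj.2) (castP (fin_data hc).2.1 hc.hj.2)
    ((res (emb ℓ (fin D cq.1 cq.2) (MhP ℓ Mh cq.1 (fin D cq.1 cq.2)) (Pj ℓ k P cq.1) cq.2 (one_le_Pj hP cq.1) hc.hq))ᵀ
      * (((((ℓ : ℝ) + 1)) ^ fin D cq.1 cq.2) ^ 2 • cG D a c cq.1 (fin D cq.1 cq.2) cq.2 hP hc.hq)
      * res (emb ℓ (fin D cq.1 cq.2) (MhP ℓ Mh cq.1 (fin D cq.1 cq.2)) (Pj ℓ k P cq.1) cq.2 (one_le_Pj hP cq.1) hc.hq))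

/-- **THE SUMMAND `h_□G′(□)v_□` OF (2.37)**. [cite: Balaban1984PropagatorsII, (2.37) p.229] -/
def aX (hP : ∀ μ, 1 ≤ P μ) (cq : ℕ × (Fin (d + 1) → ℤ)) (hc : CubeData D cq) :
    Matrix ↥(boxDom (N0 ℓ Mh k P)) ↥(boxDom (N0 ℓ Mh k P)) ℝ :=
  Matrix.diagonal (uX cq) * gX D a c hP cq hc * Matrix.diagonal (vX D cq)

/-- **THE SUMMAND `K(h_□)G′(□)v_□` OF `R` (2.38)**, as the padded LOCAL two-level commutator term
`resᵀ·(K_□(h_□)·gTwoLevel·v′_□)·res` transported by the cast — the object bounded by (2.44).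
[cite: Balaban1984PropagatorsII, (2.38) p.229, (2.44) p.230] -/
def bX (hP : ∀ μ, 1 ≤ P μ) (cq : ℕ × (Fin (d + 1) → ℤ)) (hc : CubeData D cq) :
    Matrix ↥(boxDom (N0 ℓ Mh k P)) ↥(boxDom (N0 ℓ Mh k P)) ℝ :=
  Matrix.reindex (castP (fin_data hc).2.1 hc.hj.2) (castP (fin_data hc).2.1 hc.hj.2)
    ((res (emb ℓ (fin D cq.1 cq.2) (MhP ℓ Mh cq.1 (fin D cq.1 cq.2)) (Pj ℓ k P cq.1) cq.2 (one_le_Pj hP cq.1) hc.hq))ᵀ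
      * (kComm (cOp D a c cq.1 (fin D cq.1 cq.2) cq.2 hP hc.hq)
            (hLoc ℓ (fin D cq.1 cq.2) (MhP ℓ Mh cq.1 (fin D cq.1 cq.2)) (Pj ℓ k P cq.1) cq.2)
          * cG D a c cq.1 (fin D cq.1 cq.2) cq.2 hP hc.hq
          * Matrix.diagonal ((fun z => vFun D cq.1 cq.2 z.1)
              ∘ emb ℓ (fin D cq.1 cq.2) (MhP ℓ Mh cq.1 (fin D cq.1 cq.2)) (Pj ℓ k P cq.1) cq.2 (one_le_Pj hP cq.1)
                  hc.hq))
      * res (emb ℓ (fin D cq.1 cq.2) (MhP ℓ Mh cq.1 (fin D cq.1 cq.2)) (Pj ℓ k P cq.1) cq.2 (one_le_Pj hP cq.1) hc.hq))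

/-- **`G′₀ = Σ_{□∈𝒟} h_□G′(□)v_□` (2.37)** for the genuine `k`-level operator on the box. [cite: Balaban1984PropagatorsII, (2.37) p.229] -/
def gZeroML (hP : ∀ μ, 1 ≤ P μ) : Matrix ↥(boxDom (N0 ℓ Mh k P)) ↥(boxDom (N0 ℓ Mh k P)) ℝ :=
  ∑ cq ∈ (cubeSet D).attach, aX D a c hP cq.1 (cubeData_of_mem cq.2)

/-- **`R = Σ_{□∈𝒟} K(h_□)G′(□)v_□` (2.38)** for the genuine `k`-level operator on the box. [cite: Balaban1984PropagatorsII, (2.38) p.229] -/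
def rML (hP : ∀ μ, 1 ≤ P μ) : Matrix ↥(boxDom (N0 ℓ Mh k P)) ↥(boxDom (N0 ℓ Mh k P)) ℝ :=
  ∑ cq ∈ (cubeSet D).attach, bX D a c hP cq.1 (cubeData_of_mem cq.2)

variable {D a c}

/-- reindexing along one equivalence is multiplicative. [folklore] -/
private theorem reindex_mul' {X Y : Type*} [Fintype X] [Fintype Y] (e : X ≃ Y) (A B : Matrix X X ℝ) :
    Matrix.reindex e e A * Matrix.reindex e e B = Matrix.reindex e e (A * B) := by
  simp only [Matrix.reindex_apply, Matrix.submatrix_mul_equiv]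

/-- reindexing a diagonal matrix. [folklore] -/
private theorem reindex_diagonal' {X Y : Type*} [DecidableEq X] [DecidableEq Y] (e : X ≃ Y) (f : X → ℝ) :
    Matrix.reindex e e (Matrix.diagonal f) = Matrix.diagonal (f ∘ e.symm) := by
  rw [Matrix.reindex_apply, Matrix.submatrix_diagonal_equiv]

/-- reindexing is compatible with subtraction. [folklore] -/
private theorem reindex_sub' {X Y : Type*} (e : X ≃ Y) (A B : Matrix X X ℝ) :
    Matrix.reindex e e (A - B) = Matrix.reindex e e A - Matrix.reindex e e B := by
  simp only [Matrix.reindex_apply, Matrix.submatrix_sub]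
  rfl

/-- a finite sum of diagonal matrices is the diagonal matrix of the sum. [folklore] -/
private theorem sum_diagonal {X ι : Type*} [DecidableEq X] (s : Finset ι) (f : ι → X → ℝ) :
    ∑ i ∈ s, Matrix.diagonal (f i) = Matrix.diagonal (fun x => ∑ i ∈ s, f i x) := by
  classical
  induction s using Finset.induction_on with
  | empty => simp
  | insert a s ha ih =>
      rw [Finset.sum_insert ha, ih, Matrix.diagonal_add]
      congr 1
      funext x
      rw [Finset.sum_insert ha]

/-- **`Δ′_a` TIMES ONE SUMMAND**: `Δ′_a·(h_□G′(□)v_□) = h_□v_□ − K(h_□)G′(□)v_□` on the reference presentation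
(`mlOp_mul_term` for the active cube, with its two-level window from (2.2), transported by the cast).
[cite: Balaban1984PropagatorsII, (2.37)–(2.38) p.229] -/
theorem mlOp_mul_aX (hℓ : 1 ≤ ℓ) (hR : 2 * (ℓ + 1) ≤ R) (hP : ∀ μ, 1 ≤ P μ) (hMh : 1 ≤ Mh)
    (ha : ∀ i, 1 ≤ i → 0 < a i) (hcpos : ∀ i, 1 ≤ i → 0 < c i)
    (hac : ∀ i, 1 ≤ i → a (i + 1) = aNext ℓ (a i) (c i))
    (cq : ℕ × (Fin (d + 1) → ℤ)) (hc : CubeData D cq) :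
    mlOp (N0 ℓ Mh k P) ℓ k D.lev a * aX D a c hP cq hc
      = Matrix.diagonal (fun z => uX cq z * vX D cq z) - bX D a c hP cq hc := by
  obtain ⟨hi1, hij, hji, hdown, hup⟩ := fin_data hc
  have hjk := hc.hj.2
  have hwin := window_of_active (D := D) hℓ hR hP hMh hi1 hij hjk hc.hq hc.hact hdown hup
  have hterm := mlOp_mul_term (D := D) (a := a) (c := c) hℓ hP hMh hc.hq hi1 hij hjk (ha _ hi1) (hcpos _ hi1)
    (hac _ hi1) hwin (fun z => vFun D cq.1 cq.2 z.1)
  have hE : mlOp (N0 ℓ Mh k P) ℓ k D.lev a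
      = Matrix.reindex (castP hij hjk) (castP hij hjk) (Ep D a cq.1 (fin D cq.1 cq.2)) :=
    mlOp_eq_reindex (ℓ := ℓ) (k := k) (Np_eq (ℓ := ℓ) (Mh := Mh) (P := P) hij hjk) D.lev a
  -- the cut-offs as transported diagonal matrices (pointwise identities, rewritten with the cast's value lemma)
  have hu : Matrix.reindex (castP hij hjk) (castP hij hjk)
        (Matrix.diagonal (hΩ ℓ (fin D cq.1 cq.2) (MhP ℓ Mh cq.1 (fin D cq.1 cq.2)) (Pj ℓ k P cq.1) cq.2))
      = Matrix.diagonal (uX (ℓ := ℓ) (Mh := Mh) (k := k) (P := P) cq) := by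
    rw [reindex_diagonal']
    refine congrArg Matrix.diagonal (funext fun z => ?_)
    rw [Function.comp_apply, ← uFun_eq_hΩ hij cq.2]
    simp only [uX, castP, boxCast_symm_apply_val]
  have hv : Matrix.reindex (castP hij hjk) (castP hij hjk) (Matrix.diagonal (fun z => vFun D cq.1 cq.2 z.1))
      = Matrix.diagonal (vX D cq) := by
    rw [reindex_diagonal']
    refine congrArg Matrix.diagonal (funext fun z => ?_)
    rw [Function.comp_apply]
    simp only [vX, castP, boxCast_symm_apply_val]
  have huv : Matrix.reindex (castP hij hjk) (castP hij hjk)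
        (Matrix.diagonal (fun z => hΩ ℓ (fin D cq.1 cq.2) (MhP ℓ Mh cq.1 (fin D cq.1 cq.2)) (Pj ℓ k P cq.1) cq.2 z
          * vFun D cq.1 cq.2 z.1))
      = Matrix.diagonal (fun z => uX (ℓ := ℓ) (Mh := Mh) (k := k) (P := P) cq z * vX D cq z) := by
    rw [reindex_diagonal']
    refine congrArg Matrix.diagonal (funext fun z => ?_)
    rw [Function.comp_apply, ← uFun_eq_hΩ hij cq.2]
    simp only [uX, vX, castP, boxCast_symm_apply_val]
  -- everything on the presentation `(j, i)`, then `mlOp_mul_term`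
  have hgX : gX D a c hP cq hc = Matrix.reindex (castP hij hjk) (castP hij hjk)
      ((res (emb ℓ (fin D cq.1 cq.2) (MhP ℓ Mh cq.1 (fin D cq.1 cq.2)) (Pj ℓ k P cq.1) cq.2 (one_le_Pj hP cq.1)
          hc.hq))ᵀ
        * (((((ℓ : ℝ) + 1)) ^ fin D cq.1 cq.2) ^ 2 • cG D a c cq.1 (fin D cq.1 cq.2) cq.2 hP hc.hq)
        * res (emb ℓ (fin D cq.1 cq.2) (MhP ℓ Mh cq.1 (fin D cq.1 cq.2)) (Pj ℓ k P cq.1) cq.2 (one_le_Pj hP cq.1)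
          hc.hq)) := rfl
  have hbX : bX D a c hP cq hc = Matrix.reindex (castP hij hjk) (castP hij hjk)
      ((res (emb ℓ (fin D cq.1 cq.2) (MhP ℓ Mh cq.1 (fin D cq.1 cq.2)) (Pj ℓ k P cq.1) cq.2 (one_le_Pj hP cq.1)
          hc.hq))ᵀ
        * (kComm (cOp D a c cq.1 (fin D cq.1 cq.2) cq.2 hP hc.hq)
              (hLoc ℓ (fin D cq.1 cq.2) (MhP ℓ Mh cq.1 (fin D cq.1 cq.2)) (Pj ℓ k P cq.1) cq.2)
            * cG D a c cq.1 (fin D cq.1 cq.2) cq.2 hP hc.hq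
            * Matrix.diagonal ((fun z => vFun D cq.1 cq.2 z.1)
                ∘ emb ℓ (fin D cq.1 cq.2) (MhP ℓ Mh cq.1 (fin D cq.1 cq.2)) (Pj ℓ k P cq.1) cq.2 (one_le_Pj hP cq.1)
                    hc.hq))
        * res (emb ℓ (fin D cq.1 cq.2) (MhP ℓ Mh cq.1 (fin D cq.1 cq.2)) (Pj ℓ k P cq.1) cq.2 (one_le_Pj hP cq.1)
          hc.hq)) := rfl
  unfold aX
  rw [hgX, hbX, hE, ← hu, ← hv, reindex_mul', reindex_mul', reindex_mul', ← huv, ← reindex_sub']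
  exact congrArg _ hterm

/-- **(2.36) FOR THE COVER**: `Σ_{□∈𝒟} u_□(z)v_□(z) = 1` at every site — the (1.118) identity `Σ_q h_q² = 1` of the level
of `z` (`B6Partition236TwoLevelBox.sum_hq_sq`), the other levels being cut away by `1_{B^j(Λ_j)}` and the inactive
cubes of that level vanishing at `z`. [cite: Balaban1984PropagatorsII, (2.36) p.229; Balaban1984PropagatorsI, (1.118) p.36] -/
theorem sum_uv_eq_one (hMh : 1 ≤ Mh) (z : ↥(boxDom (N0 ℓ Mh k P))) :
    ∑ cq ∈ (cubeSet D).attach, uX cq.1 z * vX D cq.1 z = 1 := by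
  classical
  rw [Finset.sum_attach (cubeSet D) (fun cq => uX cq z * vX D cq z)]
  unfold cubeSet
  rw [Finset.sum_filter, Finset.sum_product]
  have hj₀mem : D.lev z.1 ∈ Finset.Icc 1 k := Finset.mem_Icc.2 ⟨D.one_le_lev _, D.lev_le _⟩
  have hN1 : 1 ≤ (ℓ + 1) ^ D.lev z.1 * ((ℓ + 1) * Mh) := Nat.one_le_iff_ne_zero.2 (by positivity)
  have hS : ∀ μ, N0 ℓ Mh k P μ = (ℓ + 1) ^ D.lev z.1 * ((ℓ + 1) * Mh) * Pj ℓ k P (D.lev z.1) μ := by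
    intro μ
    have hpow : (ℓ + 1) ^ k = (ℓ + 1) ^ D.lev z.1 * (ℓ + 1) ^ (k - D.lev z.1) := by
      rw [← pow_add, Nat.add_sub_cancel' (D.lev_le z.1)]
    simp only [N0, Pj]
    rw [hpow]
    ring
  -- every level other than `lev z` contributes zero; at `lev z` the indicator conditions are automatic
  have hrow : ∀ j ∈ Finset.Icc 1 k, ∑ q ∈ ctrs (Pj ℓ k P 1),
      (if (j, q).2 ∈ ctrs (Pj ℓ k P (j, q).1) ∧ Active D (j, q).1 (j, q).2 then uX (j, q) z * vX D (j, q) z else 0)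
        = if j = D.lev z.1 then 1 else 0 := by
    intro j _
    by_cases hjj : j = D.lev z.1
    · rw [if_pos hjj]
      subst hjj
      have hterm : ∀ q ∈ ctrs (Pj ℓ k P 1),
          (if (D.lev z.1, q).2 ∈ ctrs (Pj ℓ k P (D.lev z.1, q).1) ∧ Active D (D.lev z.1, q).1 (D.lev z.1, q).2
            then uX (D.lev z.1, q) z * vX D (D.lev z.1, q) z else 0) = uFun ℓ Mh (D.lev z.1) q z.1 ^ 2 := by
        intro q _
        dsimp only
        by_cases hu : uFun ℓ Mh (D.lev z.1) q z.1 = 0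
        · simp [uX, vX, vFun, hu]
        · have hqj : q ∈ ctrs (Pj ℓ k P (D.lev z.1)) := mem_ctrs_of_hq_ne_zero hN1 hS z.2 hu
          have hact : Active D (D.lev z.1) q := ⟨z.1, z.2, rfl, hu⟩
          rw [if_pos ⟨hqj, hact⟩]
          simp only [uX, vX, vFun, if_true, mul_one]
          ring
      rw [Finset.sum_congr rfl hterm, ← Finset.sum_subset (ctrs_Pj_subset (k := k) (P := P) (D.one_le_lev z.1))
        (fun q _ hq => by
          have h0 : uFun ℓ Mh (D.lev z.1) q z.1 = 0 := by
            by_contra h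
            exact hq (mem_ctrs_of_hq_ne_zero hN1 hS z.2 h)
          rw [h0]; ring)]
      exact sum_hq_sq hN1 hS z.2
    · rw [if_neg hjj]
      refine Finset.sum_eq_zero fun q _ => ?_
      dsimp only
      have hne : ¬ D.lev z.1 = j := fun h => hjj h.symm
      simp [uX, vX, vFun, hne]
  rw [Finset.sum_congr rfl hrow]
  simp [hj₀mem]

/-- **[B6] (2.38) FOR THE GENUINE `k`-LEVEL OPERATOR ON A BOX**: `Δ′_a·G′₀ = 1 − R` with `G′₀ = Σ_{□∈𝒟} h_□G′(□)v_□`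
over the multi-size cover (genuine two-level cube propagators at every level) and `R = Σ_{□∈𝒟} K(h_□)G′(□)v_□`, each
term of `R` the padded LOCAL commutator term of its cube — for every nested family (2.1)–(2.2) with `R ≥ 2L`, every
`k ≥ 1`, `L ≥ 2`, `M_h ≥ 1`, every box, and every positive weights with `a_{i+1} = aNext ℓ a_i c_i`.
[cite: Balaban1984PropagatorsII, (2.36)–(2.38) p.229] -/
theorem eq238_multiLevelBox (hℓ : 1 ≤ ℓ) (hR : 2 * (ℓ + 1) ≤ R) (hP : ∀ μ, 1 ≤ P μ) (hMh : 1 ≤ Mh)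
    (ha : ∀ i, 1 ≤ i → 0 < a i) (hcpos : ∀ i, 1 ≤ i → 0 < c i)
    (hac : ∀ i, 1 ≤ i → a (i + 1) = aNext ℓ (a i) (c i)) :
    mlOp (N0 ℓ Mh k P) ℓ k D.lev a * gZeroML D a c hP = 1 - rML D a c hP := by
  unfold gZeroML rML
  rw [Finset.mul_sum]
  rw [Finset.sum_congr rfl fun cq _ => mlOp_mul_aX hℓ hR hP hMh ha hcpos hac cq.1 (cubeData_of_mem cq.2),
    Finset.sum_sub_distrib, sum_diagonal]
  congr 1
  have : (fun x : ↥(boxDom (N0 ℓ Mh k P)) => ∑ cq ∈ (cubeSet D).attach,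
      uX cq.1 x * vX D cq.1 x) = fun _ => 1 := funext fun z => sum_uv_eq_one (D := D) hMh z
  rw [this]
  exact Matrix.diagonal_one

end Assembly

end

end Literature.MathematicalPhysics.QuantumFieldTheory.Balaban1983to89.B6Eq238MultiLevelBox
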